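import Summits.AtomisticToContinuum.FouriersLaw.Theses.DiluteCellGaussianiser
import Literature.MeasureTheory.Lebesgue.VitaliSet

/-!
# Refutation of `DiluteCellGaussianiser.FarFieldGaussianity` (stmt-AtomisticToContinuum-12890)

The crux quantifies over ALL `D₀ D : InfiniteChain.Dynamics _` and all merely BOUNDED `θ : ℝ → ℝ`.
Two intended hypotheses are missing; junk models exploit them. (1) `θ` need not be measurable: for
a Vitali indicator `θ` and `ε ≠ 0` the profile `T + ε θ` is not a.e.-measurable on the band, so
every spectral covariance `profileCovPP/QQ/QP` is the junk Bochner value `0` and `dirac 0` is a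
"Gaussian profile state with profile `T + ε θ`". (2) `IsDrivenState` never puts `μ` on
`D₀.carrier`, and `Dynamics` allows `carrier = ∅` with any `flow`: for `D₀ = ⟨∅, fun _ _ => 0, …⟩`
the "incoming state" of EVERY probability measure is `dirac 0`. So every `D`-invariant `L²` law
is a driven state. Take `ω₂ = 1/2`, `lam = β = T = 1`, `D :=` identity flow on the equilibria of
the cell chain (legal: constant orbits solve the ODE, `p ≡ 0` forces uniqueness) and `μ :=` law of
the explicit equilibrium `q_0 = 0, q_1 = c`, `q_i = (2c+c³)/3 · 2^i - (2c+4c³)/3 · 2^{-i}`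
(`i ≥ 1`), `q_i = (2/3)(c+c³)(2^i - 2^{-i})` (`i ≤ 0`) — the host recursion `q_{i+1} + q_{i-1} =
(5/2) q_i` has the modes `2^{±i}` — with `c ~ U[1,2]`: the window at `-x` escapes to infinity,
`∫ (1 + q_{-x}²)⁻¹ dμ ≤ 1/(x+1) → 0`, while `∫ (1 + q_0²)⁻¹ dν > 0` for every Gaussian
(probability) `ν`, so the conclusion fails at `s = -1`.
CLASS refuted-misstated. REPAIR C′: `θ : SpectralProfile` with an a.e. bound (as in
`HasGaussianScatteringStates`; at least `Measurable θ`) AND `∀ᵐ σ ∂μ, σ ∈ D₀.carrier` with `D₀`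
pinned to the tempered LLL host dynamics (`carrier ⊇ ⋃ r, expTempered r`). The witness misses C′
(a law carried by cell equilibria then has a `p ≡ 0` incoming state, never a `T > 0` profile
state). All auxiliaries are private theorems; the junk dynamics, the equilibrium family and the
observable are built inside the refutation. Crux attack 2026-08-15,
refuter-rattack-stmt-AtomisticToContinuum-12890-0.
-/

noncomputable section

namespace Summit.AtomisticToContinuum.FouriersLaw.Theses.DiluteCellGaussianiser

open scoped BigOperators Topology Manifold Classical MeasureTheory ProbabilityTheory Matrix InnerProductSpace ComplexConjugate ContinuousMap
open Filter Set Function TopologicalSpace MeasureTheory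

/-- **Record of the replaced/dropped route item `FarFieldGaussianity`** = stmt-AtomisticToContinuum-12890 (ledger signature verbatim, in
the route file's namespace and `open` context; NOT a route item): after `DiluteCellGaussianiserFarFieldGaussianity_refuted` (below) closed the
item `refuted` at afc8f9ed04f2, the route repair (`restate` under a new name, or `drop`) removed
this constant from the gate-written Theses file, while the Theorems file below — append-only,
statement text fixed — still names it ("Unknown identifier" in the full builds of 2026-08-16).
Re-declared here under its original fully-qualified name and definiens solely so that this record
keeps elaborating. FALSE (refuted below). -/
def FarFieldGaussianity : Prop :=
  ∀ ω₂ lam β : ℝ, 0 < ω₂ → 0 < lam → 0 < β → ∀ T : ℝ, 0 < T → ∀ (D₀ : (Literature.MathematicalPhysics.KineticTheory.HeatConduction.harmonicHostWithCell ω₂ lam β ∅).Dynamics) (D : (Literature.MathematicalPhysics.KineticTheory.HeatConduction.harmonicHostWithCell ω₂ lam β {0}).Dynamics) (θ : ℝ → ℝ), (∃ C : ℝ, ∀ k, |θ k| ≤ C) → ∃ ε₀ : ℝ, 0 < ε₀ ∧ ∀ (ε : ℝ) (μ : MeasureTheory.Measure Literature.MathematicalPhysics.KineticTheory.HeatConduction.ChainConfig),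 |ε| < ε₀ → Literature.MathematicalPhysics.KineticTheory.HeatConduction.IsDrivenState ω₂ D₀ D T ε θ μ → ∀ s : ℤ, (s = 1 ∨ s = -1) → ∃ (ν : MeasureTheory.Measure Literature.MathematicalPhysics.KineticTheory.HeatConduction.ChainConfig) (ϑ : ℝ → ℝ), ProbabilityTheory.IsGaussian ν ∧ Literature.MathematicalPhysics.KineticTheory.HeatConduction.IsProfileState ω₂ ν ϑ ∧ ∀ (Λ : Finset ℤ) (F : Literature.MathematicalPhysics.KineticTheory.HeatConduction.ChainConfig → ℝ), Literature.MathematicalPhysics.KineticTheory.HeatConduction.IsSmoothLocalObservable Λ F → (∃ C : ℝ, ∀ σ, |F σ| ≤ C) → Filter.Tendsto (fun x : ℕ => ∫ σ, F (fun i : ℤ => σ (i + s * x)) ∂μ) Filter.atTop (nhds (∫ σ, F σ ∂ν))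

end Summit.AtomisticToContinuum.FouriersLaw.Theses.DiluteCellGaussianiser

namespace Summit.AtomisticToContinuum.FouriersLaw.Theorems
open MeasureTheory ProbabilityTheory Filter Set Topology Literature.MathematicalPhysics.KineticTheory.HeatConduction

/-- A `{0,1}`-valued `θ` (Vitali indicator inside `(-1,1) ⊆ band`) such that no profile `T + ε θ`,
`ε ≠ 0`, is a.e.-measurable for the band measure. [folklore] -/
private theorem exists_theta : ∃ θ : ℝ → ℝ, (∀ k, |θ k| ≤ 1) ∧
    ∀ T ε : ℝ, ε ≠ 0 → ¬ AEMeasurable (fun k => T + ε * θ k) hostBandMeasure := by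
  obtain ⟨A, -, hS⟩ := Literature.MeasureTheory.Lebesgue.Vitali.exists_innerNull_not_nullMeasurableSet
    (volume : Measure ℝ) (ContinuousLinearMap.id ℝ ℝ) (e := 1) rfl (fun x => by simp) (by simp) 0 zero_lt_one
  set S := A ∩ Metric.ball (0 : ℝ) 1 with hSdef
  have hsub : S ⊆ hostBand := by
    intro k hk
    have hk1 : -1 < k ∧ k < 1 := by simpa [Metric.mem_ball, Real.dist_eq, abs_lt] using hk.2
    exact ⟨by linarith [Real.pi_gt_three], by linarith [Real.pi_gt_three]⟩
  have hSb : ¬ NullMeasurableSet S hostBandMeasure := by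
    intro hnull
    refine hS S Subset.rfl inter_subset_left ?_
    obtain ⟨u, hus, hu, hue⟩ := hnull.exists_measurable_subset_ae_eq
    refine hu.nullMeasurableSet.congr ?_
    rw [show hostBandMeasure = volume.restrict hostBand from rfl] at hue
    filter_upwards [(ae_restrict_iff' measurableSet_hostBand).1 hue] with x hx
    by_cases hxb : x ∈ hostBand
    · exact hx hxb
    · apply propext
      exact ⟨fun hxu => absurd (hsub (hus hxu)) hxb, fun hxs => absurd (hsub hxs) hxb⟩
  refine ⟨S.indicator fun _ => 1, fun k => ?_, fun T ε hε h => hSb ?_⟩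
  · by_cases hk : k ∈ S <;> simp [hk]
  · have hθ : AEMeasurable (S.indicator fun _ => (1 : ℝ)) hostBandMeasure := by
      have hfun : (fun k => (T + ε * S.indicator (fun _ => (1 : ℝ)) k - T) / ε) =
          S.indicator fun _ => 1 := by
        funext k; rw [add_sub_cancel_left, mul_div_cancel_left₀ _ hε]
      rw [← hfun]
      exact (h.sub_const T).div_const ε
    convert hθ.nullMeasurableSet_preimage (measurableSet_singleton (1 : ℝ)) using 1
    ext k
    by_cases hk : k ∈ S <;> simp [hk]

/-- Junk value: `∫ ϑ w = 0` over the band when `ϑ` is not a.e.-measurable and the measurable weight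
`w` is a.e. non-zero. [folklore] -/
private theorem integral_mul_eq_zero {ϑ : ℝ → ℝ} (hϑ : ¬ AEMeasurable ϑ hostBandMeasure) {w : ℝ → ℝ}
    (hw : Measurable w) (hw0 : ∀ᵐ k ∂hostBandMeasure, w k ≠ 0) :
    ∫ k, ϑ k * w k ∂hostBandMeasure = 0 := by
  refine integral_undef fun hint => hϑ ?_
  have h2 : AEMeasurable (fun k => ϑ k * w k * (w k)⁻¹) hostBandMeasure :=
    hint.aestronglyMeasurable.aemeasurable.mul hw.inv.aemeasurable
  refine h2.congr ?_
  filter_upwards [hw0] with k hk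
  rw [mul_assoc, mul_inv_cancel₀ hk, mul_one]

/-- A function with countably many zeros is a.e. non-zero for the band measure. [folklore] -/
private theorem ae_ne_zero {g : ℝ → ℝ} (hg : {k | g k = 0}.Countable) :
    ∀ᵐ k ∂hostBandMeasure, g k ≠ 0 := by
  rw [ae_iff]
  change volume.restrict hostBand _ = 0
  refine nonpos_iff_eq_zero.1 ((Measure.le_iff'.1 Measure.restrict_le_self _).trans (le_of_eq ?_))
  exact (hg.mono fun k hk => not_not.1 hk).measure_zero volume

/-- Junk: the Dirac mass at `0` is a profile state for every non-a.e.-measurable profile. [folklore] -/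
private theorem isProfileState_dirac {ω₂ : ℝ} (hω : 0 < ω₂) {ϑ : ℝ → ℝ}
    (hϑ : ¬ AEMeasurable ϑ hostBandMeasure) : IsProfileState ω₂ (Measure.dirac (0 : ChainConfig)) ϑ := by
  have hdisp : Measurable (hostDispersion ω₂) := by unfold hostDispersion; fun_prop
  have hcos : ∀ j : ℝ, ∀ᵐ k ∂hostBandMeasure, Real.cos (k * j) ≠ 0 := by
    intro j; by_cases hj : j = 0
    · exact ae_of_all _ fun k => by simp [hj]
    · refine ae_ne_zero ((countable_range fun z : ℤ => (2 * (z : ℝ) + 1) * Real.pi / 2 / j).mono fun k hk => ?_)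
      obtain ⟨z, hz⟩ := Real.cos_eq_zero_iff.1 hk
      exact ⟨z, (div_eq_iff hj).2 hz.symm⟩
  have hsin : ∀ j : ℝ, j ≠ 0 → ∀ᵐ k ∂hostBandMeasure, Real.sin (k * j) ≠ 0 := by
    intro j hj
    refine ae_ne_zero ((countable_range fun z : ℤ => (z : ℝ) * Real.pi / j).mono fun k hk => ?_)
    obtain ⟨z, hz⟩ := Real.sin_eq_zero_iff.1 hk
    exact ⟨z, (div_eq_iff hj).2 hz⟩
  have hPP : ∀ m n : ℤ, profileCovPP ϑ m n = 0 := fun m n => by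
    unfold profileCovPP
    rw [integral_mul_eq_zero hϑ (by fun_prop) (hcos _), mul_zero]
  have hQQ : ∀ m n : ℤ, profileCovQQ ω₂ ϑ m n = 0 := fun m n => by
    unfold profileCovQQ
    have h : (fun k => ϑ k / hostDispersion ω₂ k ^ 2 * Real.cos (k * ((m : ℝ) - n))) =
        fun k => ϑ k * (Real.cos (k * ((m : ℝ) - n)) / hostDispersion ω₂ k ^ 2) := by
      funext k; ring
    rw [h, integral_mul_eq_zero hϑ ?_ ?_, mul_zero]
    · exact (Real.continuous_cos.measurable.comp (measurable_id.mul_const _)).div (hdisp.pow_const 2)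
    · filter_upwards [hcos ((m : ℝ) - n)] with k hk
      exact div_ne_zero hk (pow_ne_zero _ (hostDispersion_pos hω k).ne')
  have hQP : ∀ m n : ℤ, profileCovQP ω₂ ϑ m n = 0 := fun m n => by
    unfold profileCovQP
    by_cases hmn : ((m : ℝ) - n) = 0
    · simp [hmn]
    · have h : (fun k => ϑ k / hostDispersion ω₂ k * Real.sin (k * ((m : ℝ) - n))) =
          fun k => ϑ k * (Real.sin (k * ((m : ℝ) - n)) / hostDispersion ω₂ k) := by
        funext k; ring
      rw [h, integral_mul_eq_zero hϑ ?_ ?_, mul_zero, neg_zero]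
      · exact (Real.continuous_sin.measurable.comp (measurable_id.mul_const _)).div hdisp
      · filter_upwards [hsin _ hmn] with k hk
        exact div_ne_zero hk (hostDispersion_pos hω k).ne'
  refine ⟨fun m => by simp [integral_dirac], fun m n => ?_⟩
  rw [hQQ, hPP, hQP]
  simp [covariance, integral_dirac]

/-- `dirac 0` on `ChainConfig` is Gaussian (Mathlib's instance wants a normed space). [folklore] -/
private theorem isGaussian_dirac_zero : IsGaussian (Measure.dirac (0 : ChainConfig)) := by
  refine ⟨fun L => ?_⟩
  rw [Measure.map_dirac' L.continuous.measurable, variance_dirac, integral_dirac, map_zero,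
    Real.toNNReal_zero, gaussianReal_zero_var]

/-- A solution along which all momenta vanish is constant (uniqueness for the identity flow on the
equilibria). [folklore] -/
private theorem eq_of_momenta_zero {P : InfiniteChain} {γ : ℝ → ChainConfig}
    (hγ : ∀ t i, (γ t i).2 = 0) (hsol : P.IsSolution γ) (t : ℝ) : γ t = γ 0 := by
  funext i
  have hq : ∀ s, HasDerivAt (fun s => (γ s i).1) 0 s := fun s => by
    have h := (hsol i s).1
    rwa [hγ s i] at h
  exact Prod.ext (is_const_of_deriv_eq_zero (f := fun s => (γ s i).1)
    (fun s => (hq s).differentiableAt) (fun s => (hq s).deriv) t 0) (by rw [hγ t i, hγ 0 i])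

/-- The equilibrium set of a quartic profile chain is measurable. [folklore] -/
private theorem measurableSet_eqSet (ω₂ : ℝ) (lam β : ℤ → ℝ) : MeasurableSet
    {σ : ChainConfig | (∀ i, (σ i).2 = 0) ∧ ∀ i, (quarticChain ω₂ lam β).force σ i = 0} := by
  have hf : ∀ i, Measurable fun σ : ChainConfig => (quarticChain ω₂ lam β).force σ i := fun i => by
    simp_rw [quarticChain_force]
    have h : ∀ j : ℤ, Measurable fun σ : ChainConfig => (σ j).1 := fun j => (measurable_pi_apply j).fst
    fun_prop
  have h : {σ : ChainConfig | (∀ i, (σ i).2 = 0) ∧ ∀ i, (quarticChain ω₂ lam β).force σ i = 0} =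
      ⋂ i : ℤ, ({σ | (σ i).2 = 0} ∩ {σ | (quarticChain ω₂ lam β).force σ i = 0}) := by
    ext σ
    simp only [mem_setOf_eq, mem_iInter, mem_inter_iff]
    exact ⟨fun h i => ⟨h.1 i, h.2 i⟩, fun h => ⟨fun i => (h i).1, fun i => (h i).2⟩⟩
  rw [h]
  exact MeasurableSet.iInter fun i => (measurableSet_eq_fun (measurable_pi_apply i).snd
    measurable_const).inter (measurableSet_eq_fun (hf i) measurable_const)

/-- **The closed-form configurations are equilibria of the one-cell chain** (`ω₂ = 1/2`,
`lam = β = 1`; host modes `2^{±i}`, `q_0 = 0`, `q_1 = c`). [folklore] -/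
private theorem force_eq_zero {q : ℝ → ℤ → ℝ} (hq : ∀ c i, q c i =
      if 1 ≤ i then (2 * c + c ^ 3) / 3 * (2 : ℝ) ^ i - (2 * c + 4 * c ^ 3) / 3 * (2 : ℝ) ^ (-i)
      else 2 / 3 * (c + c ^ 3) * ((2 : ℝ) ^ i - (2 : ℝ) ^ (-i))) (c : ℝ) (i : ℤ) :
    (harmonicHostWithCell (1 / 2 : ℝ) 1 1 {0}).force (fun j => (q c j, 0)) i = 0 := by
  have e1 : ∀ n : ℤ, (2 : ℝ) ^ (n + 1) = 2 ^ n * 2 := zpow_add_one₀ two_ne_zero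
  have e2 : ∀ n : ℤ, (2 : ℝ) ^ (n - 1) = 2 ^ n * 2⁻¹ := zpow_sub_one₀ two_ne_zero
  have e3 : ∀ n : ℤ, (2 : ℝ) ^ (-(n + 1)) = 2 ^ (-n) * 2⁻¹ := fun n => by
    rw [show -(n + 1) = -n - 1 by ring, zpow_sub_one₀ two_ne_zero]
  have e4 : ∀ n : ℤ, (2 : ℝ) ^ (-(n - 1)) = 2 ^ (-n) * 2 := fun n => by
    rw [show -(n - 1) = -n + 1 by ring, zpow_add_one₀ two_ne_zero]
  rcases (show i ≤ -1 ∨ i = 0 ∨ i = 1 ∨ 2 ≤ i by omega) with hi | rfl | rfl | hi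
  · rw [harmonicHostWithCell_force_of_not_mem (S := {0}) (x := i)
      (by rw [Finset.mem_singleton]; omega) (by rw [Finset.mem_singleton]; omega)]
    dsimp only
    rw [hq c (i + 1), hq c i, hq c (i - 1), if_neg (show ¬ (1 : ℤ) ≤ i + 1 by omega),
      if_neg (show ¬ (1 : ℤ) ≤ i by omega), if_neg (show ¬ (1 : ℤ) ≤ i - 1 by omega), e1, e2, e3, e4]
    ring
  · rw [harmonicHostWithCell_singleton_force_zero]
    dsimp only
    rw [hq c 0, hq c 1, hq c (-1), if_neg (show ¬ (1 : ℤ) ≤ 0 by norm_num), if_pos le_rfl,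
      if_neg (show ¬ (1 : ℤ) ≤ -1 by norm_num)]
    norm_num
    ring
  · rw [harmonicHostWithCell_singleton_force_one]
    dsimp only
    rw [hq c 1, hq c 2, hq c 0, if_pos le_rfl, if_pos (show (1 : ℤ) ≤ 2 by norm_num),
      if_neg (show ¬ (1 : ℤ) ≤ 0 by norm_num)]
    norm_num
    ring
  · rw [harmonicHostWithCell_force_of_not_mem (S := {0}) (x := i)
      (by rw [Finset.mem_singleton]; omega) (by rw [Finset.mem_singleton]; omega)]
    dsimp only
    rw [hq c (i + 1), hq c i, hq c (i - 1), if_pos (show (1 : ℤ) ≤ i + 1 by omega),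
      if_pos (show (1 : ℤ) ≤ i by omega), if_pos (show (1 : ℤ) ≤ i - 1 by omega), e1, e2, e3, e4]
    ring

/-- `c ↦ q_i(c)` is continuous for each site. [folklore] -/
private theorem continuous_q {q : ℝ → ℤ → ℝ} (hq : ∀ c i, q c i =
      if 1 ≤ i then (2 * c + c ^ 3) / 3 * (2 : ℝ) ^ i - (2 * c + 4 * c ^ 3) / 3 * (2 : ℝ) ^ (-i)
      else 2 / 3 * (c + c ^ 3) * ((2 : ℝ) ^ i - (2 : ℝ) ^ (-i))) (i : ℤ) : Continuous fun c => q c i := by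
  simp only [hq]; split_ifs <;> fun_prop

/-- The random configuration `c ↦ (q c ·, 0)` is a measurable map. [folklore] -/
private theorem measurable_cfg {q : ℝ → ℤ → ℝ} (hcont : ∀ i, Continuous fun c => q c i) :
    Measurable fun (c : ℝ) (j : ℤ) => ((q c j, 0) : ℝ × ℝ) :=
  measurable_pi_lambda _ fun j => (hcont j).measurable.prodMk measurable_const

/-- A.e. statements about the law of the random configuration, `c ~ U[1, 2]`. [folklore] -/
private theorem ae_cfg {q : ℝ → ℤ → ℝ} (hcont : ∀ i, Continuous fun c => q c i) {p : ChainConfig → Prop}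
    (hp : MeasurableSet {σ | p σ}) (h : ∀ c ∈ Icc (1 : ℝ) 2, p fun j => (q c j, 0)) :
    ∀ᵐ σ ∂Measure.map (fun (c : ℝ) (j : ℤ) => ((q c j, 0) : ℝ × ℝ)) (volume.restrict (Icc 1 2)), p σ := by
  rw [ae_map_iff (measurable_cfg hcont).aemeasurable hp]
  filter_upwards [ae_restrict_mem measurableSet_Icc] with c hc using h c hc

/-- `U[1, 2]` is a probability measure. [folklore] -/
private theorem isProbabilityMeasure_Icc : IsProbabilityMeasure ((volume : Measure ℝ).restrict (Icc 1 2)) :=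
  ⟨by simp only [Measure.restrict_apply_univ, Real.volume_Icc]; norm_num⟩

/-- **All junk in place**: for a free "dynamics" with `flow ≡ 0`, the identity flow on the
equilibria, a family of equilibria and a non-a.e.-measurable profile, the law of the random
equilibrium is a "Gaussian-driven stationary state". [folklore] -/
private theorem isDrivenState_cfg {ω₂ lam β : ℝ} (hω : 0 < ω₂) {q : ℝ → ℤ → ℝ}
    (hcont : ∀ i, Continuous fun c => q c i)
    (hforce : ∀ c i, (harmonicHostWithCell ω₂ lam β {0}).force (fun j => (q c j, 0)) i = 0) (T ε : ℝ)
    {θ : ℝ → ℝ} (hθ : ¬ AEMeasurable (fun k => T + ε * θ k) hostBandMeasure)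
    (D₀ : (harmonicHostWithCell ω₂ lam β ∅).Dynamics) (hD₀ : ∀ t σ, D₀.flow t σ = 0)
    (D : (harmonicHostWithCell ω₂ lam β {0}).Dynamics)
    (hDc : D.carrier = {σ | (∀ i, (σ i).2 = 0) ∧ ∀ i, (harmonicHostWithCell ω₂ lam β {0}).force σ i = 0})
    (hDf : ∀ t σ, D.flow t σ = σ) : IsDrivenState ω₂ D₀ D T ε θ
      (Measure.map (fun (c : ℝ) (j : ℤ) => ((q c j, 0) : ℝ × ℝ)) (volume.restrict (Icc 1 2))) := by
  haveI := isProbabilityMeasure_Icc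
  haveI := Measure.isProbabilityMeasure_map (μ := volume.restrict (Icc (1 : ℝ) 2))
    (measurable_cfg hcont).aemeasurable
  refine ⟨inferInstance, ⟨?_, fun t => ?_⟩, fun x => ⟨?_, ?_⟩, Measure.dirac 0, fun Λ F _ _ => ?_,
    isGaussian_dirac_zero, isProfileState_dirac hω hθ⟩
  · rw [hDc]
    exact ae_cfg hcont (measurableSet_eqSet ω₂ (cellProfile {0} lam) (cellProfile {0} β))
      fun c _ => ⟨fun _ => rfl, fun i => hforce c i⟩
  · rw [show D.flow t = id from funext (hDf t)]
    exact MeasurePreserving.id _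
  · obtain ⟨C, hC⟩ := isCompact_Icc.exists_bound_of_continuousOn (hcont x).continuousOn
    exact MemLp.of_bound (measurable_pi_apply x).fst.aestronglyMeasurable C
      (ae_cfg hcont (measurableSet_le (measurable_pi_apply x).fst.norm measurable_const) fun c hc => hC c hc)
  · exact MemLp.of_bound (measurable_pi_apply x).snd.aestronglyMeasurable 0
      (ae_cfg hcont (measurableSet_le (measurable_pi_apply x).snd.norm measurable_const) fun c _ => by simp)
  · simp_rw [hD₀]
    rw [integral_const, integral_dirac, probReal_univ, one_smul]
    exact tendsto_const_nhds

/-- **Escape to infinity at `-∞`**: for `F = (1 + q_0²)⁻¹` the shifted expectations along the law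
of the random equilibrium tend to `0` (`|q_{-x}| ≥ (4/3)(2^x - 2^{-x}) ≥ x`). [folklore] -/
private theorem tendsto_shift {q : ℝ → ℤ → ℝ} (hq : ∀ c i, q c i =
      if 1 ≤ i then (2 * c + c ^ 3) / 3 * (2 : ℝ) ^ i - (2 * c + 4 * c ^ 3) / 3 * (2 : ℝ) ^ (-i)
      else 2 / 3 * (c + c ^ 3) * ((2 : ℝ) ^ i - (2 : ℝ) ^ (-i))) {F : ChainConfig → ℝ}
    (hF : ∀ σ, F σ = (1 + (σ 0).1 ^ 2)⁻¹) :
    Tendsto (fun x : ℕ => ∫ σ, F (fun i : ℤ => σ (i + (-1) * (x : ℤ)))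
      ∂Measure.map (fun (c : ℝ) (j : ℤ) => ((q c j, 0) : ℝ × ℝ)) (volume.restrict (Icc 1 2)))
      atTop (𝓝 0) := by
  haveI := isProbabilityMeasure_Icc
  haveI := Measure.isProbabilityMeasure_map (μ := volume.restrict (Icc (1 : ℝ) 2))
    (measurable_cfg (continuous_q hq)).aemeasurable
  have hFm : Measurable F := by
    rw [show F = fun σ => (1 + (σ 0).1 ^ 2)⁻¹ from funext hF]
    exact (((measurable_pi_apply 0).fst.pow_const 2).const_add 1).inv
  have hFpos : ∀ σ, 0 < F σ := fun σ => by rw [hF]; positivity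
  have hbound : ∀ x : ℕ, ∀ᵐ σ ∂Measure.map (fun (c : ℝ) (j : ℤ) => ((q c j, 0) : ℝ × ℝ))
      (volume.restrict (Icc 1 2)), ‖F (fun i : ℤ => σ (i + (-1) * (x : ℤ)))‖ ≤ 1 / ((x : ℝ) + 1) := by
    intro x
    refine ae_cfg (continuous_q hq) (measurableSet_le (hFm.comp (measurable_pi_lambda _ fun _ =>
      measurable_pi_apply _)).norm measurable_const) fun c hc => ?_
    rw [hF]
    dsimp only
    rw [show (0 : ℤ) + -1 * (x : ℤ) = -(x : ℤ) by ring, hq, if_neg (show ¬ (1 : ℤ) ≤ -(x : ℤ) by omega),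
      neg_neg, zpow_neg, zpow_natCast, Real.norm_eq_abs, abs_of_pos (by positivity), one_div]
    apply inv_anti₀ (by positivity)
    have ht : (x : ℝ) + 1 ≤ 2 ^ x := by exact_mod_cast Nat.lt_two_pow_self
    have hs : ((2 : ℝ) ^ x)⁻¹ ≤ 1 := inv_le_one_of_one_le₀ (le_trans (by simp) ht)
    have hc3 : (1 : ℝ) ≤ c ^ 3 := by simpa using pow_le_pow_left₀ zero_le_one hc.1 3
    have h1 : (x : ℝ) ≤ 2 / 3 * (c + c ^ 3) * (2 ^ x - ((2 : ℝ) ^ x)⁻¹) := by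
      nlinarith [mul_nonneg (show (0 : ℝ) ≤ 2 / 3 * (c + c ^ 3) - 1 by linarith [hc.1])
        (show (0 : ℝ) ≤ 2 ^ x - ((2 : ℝ) ^ x)⁻¹ by linarith), ht, hs]
    have h2 : (x : ℝ) ^ 2 ≤ (2 / 3 * (c + c ^ 3) * (2 ^ x - ((2 : ℝ) ^ x)⁻¹)) ^ 2 :=
      pow_le_pow_left₀ x.cast_nonneg h1 2
    have h3 : (x : ℝ) ≤ (x : ℝ) ^ 2 := by exact_mod_cast Nat.le_self_pow two_ne_zero x
    nlinarith [h2, h3]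
  refine tendsto_of_tendsto_of_tendsto_of_le_of_le tendsto_const_nhds
    tendsto_one_div_add_atTop_nhds_zero_nat (fun x => integral_nonneg fun σ => (hFpos _).le) fun x => ?_
  have hb := norm_integral_le_of_norm_le_const (hbound x)
  rw [probReal_univ, mul_one] at hb
  exact le_trans (Real.le_norm_self _) hb

/-- Refutes `DiluteCellGaussianiser.FarFieldGaussianity` [refuted-misstated]: at `ω₂ = 1/2`,
`lam = β = T = 1`, with the junk free dynamics (carrier `∅`, flow `0`), the legal but degenerate
cell dynamics "identity on the equilibria", a Vitali indicator `θ` (bounded, not a.e.-measurable)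
and `ε = ε₀/2`, the law `μ` of the random equilibrium (`c ~ U[1,2]`) is a driven state (incoming
state `dirac 0`, all spectral covariances junk `0`), yet at `s = -1` its windows escape:
`∫ (1 + q_{-x}²)⁻¹ dμ → 0 < ∫ (1 + q_0²)⁻¹ dν` for every Gaussian `ν`. Repair: `θ : SpectralProfile`
a.e.-bounded and `∀ᵐ σ ∂μ, σ ∈ D₀.carrier`, `D₀` the tempered host dynamics; the witness misses the
repaired statement. [folklore] -/
theorem DiluteCellGaussianiserFarFieldGaussianity_refuted :
    ¬ Summit.AtomisticToContinuum.FouriersLaw.Theses.DiluteCellGaussianiser.FarFieldGaussianity := by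
  intro h
  obtain ⟨θ, hθb, hθ⟩ := exists_theta
  obtain ⟨q, hq⟩ : ∃ q : ℝ → ℤ → ℝ, ∀ c i, q c i =
      if 1 ≤ i then (2 * c + c ^ 3) / 3 * (2 : ℝ) ^ i - (2 * c + 4 * c ^ 3) / 3 * (2 : ℝ) ^ (-i)
      else 2 / 3 * (c + c ^ 3) * ((2 : ℝ) ^ i - (2 : ℝ) ^ (-i)) := ⟨_, fun _ _ => rfl⟩
  obtain ⟨D₀, hD₀⟩ : ∃ D₀ : (harmonicHostWithCell (1 / 2 : ℝ) 1 1 ∅).Dynamics, ∀ t σ, D₀.flow t σ = 0 :=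
    ⟨⟨∅, fun _ _ => 0, fun _ _ h => h.elim, fun _ h => h.elim, fun _ h => h.elim,
      fun _ hγ _ t => (hγ t).elim⟩, fun _ _ => rfl⟩
  obtain ⟨D, hDc, hDf⟩ : ∃ D : (harmonicHostWithCell (1 / 2 : ℝ) 1 1 {0}).Dynamics,
      D.carrier = {σ | (∀ i, (σ i).2 = 0) ∧ ∀ i, (harmonicHostWithCell (1 / 2 : ℝ) 1 1 {0}).force σ i = 0} ∧
      ∀ t σ, D.flow t σ = σ :=
    ⟨⟨{σ | (∀ i, (σ i).2 = 0) ∧ ∀ i, (harmonicHostWithCell (1 / 2 : ℝ) 1 1 {0}).force σ i = 0},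
      fun _ σ => σ, fun _ _ h => h, fun _ _ => rfl, fun _ h => InfiniteChain.isSolution_const h.1 h.2,
      fun γ hγ hsol t => eq_of_momenta_zero (fun s => (hγ s).1) hsol t⟩, rfl, fun _ _ => rfl⟩
  obtain ⟨F, hF⟩ : ∃ F : ChainConfig → ℝ, ∀ σ, F σ = (1 + (σ 0).1 ^ 2)⁻¹ := ⟨_, fun _ => rfl⟩
  obtain ⟨ε₀, hε₀, h⟩ := h (1 / 2) 1 1 (by norm_num) one_pos one_pos 1 one_pos D₀ D θ ⟨1, hθb⟩
  have hε : |ε₀ / 2| < ε₀ := by rw [abs_of_pos (by positivity)]; linarith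
  obtain ⟨ν, ϑ, hG, -, hconv⟩ := h (ε₀ / 2) _ hε (isDrivenState_cfg (by norm_num) (continuous_q hq)
    (force_eq_zero hq) 1 (ε₀ / 2) (hθ 1 (ε₀ / 2) (by positivity)) D₀ hD₀ D hDc hDf) (-1) (Or.inr rfl)
  have hFpos : ∀ σ, 0 < F σ := fun σ => by rw [hF]; positivity
  have hFle : ∀ σ, |F σ| ≤ 1 := fun σ => by
    rw [abs_of_pos (hFpos σ), hF]
    exact inv_le_one_of_one_le₀ (by nlinarith [sq_nonneg (σ 0).1])
  have hFs : IsSmoothLocalObservable {0} F := by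
    refine ⟨fun x => (1 + (x ⟨0, Finset.mem_singleton_self 0⟩).1 ^ 2)⁻¹, ?_,
      ⟨1, zero_le_one, 0, fun x => ?_⟩, fun σ => hF σ⟩
    · exact ContDiff.inv (by fun_prop) (fun x => by positivity)
    · rw [pow_zero, mul_one, abs_of_pos (by positivity)]
      exact inv_le_one_of_one_le₀ (by nlinarith [sq_nonneg (x ⟨0, Finset.mem_singleton_self 0⟩).1])
  have h0 : ∫ σ, F σ ∂ν = 0 :=
    tendsto_nhds_unique (hconv {0} F hFs ⟨1, hFle⟩) (tendsto_shift hq hF)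
  have hint : Integrable F ν := (integrable_const (1 : ℝ)).mono' hFs.measurable.aestronglyMeasurable
    (ae_of_all _ fun σ => by rw [Real.norm_eq_abs]; exact hFle σ)
  have hfalse : ∀ᵐ σ ∂ν, False :=
    ((integral_eq_zero_iff_of_nonneg (fun σ => (hFpos σ).le) hint).1 h0).mono fun σ hσ => (hFpos σ).ne' hσ
  simp only [ae_iff, not_false_eq_true, setOf_true] at hfalse
  exact (IsProbabilityMeasure.ne_zero ν) (Measure.measure_univ_eq_zero.1 hfalse)

end Summit.AtomisticToContinuum.FouriersLaw.Theorems
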